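import Literature.Computability.Cryptography.HallgrenClassGroup

/-!
# Stub `stub_oneSidedNG` of line `Sketch` (skeleton v4) for the crux `ArithStatLadder.IqThreeNotPPoly`

Exact one-sidedness (the NO side) of the planted Nagell family: on modulus `N` and seed `k` put
`c = 1 + 2³⁰ N⁵`, `s = 1 + 6 c N k` and `d = N s · (4 c³ ∸ N s)` (truncated subtraction in `ℕ`).
If `N` is NOT squarefree then `−d` is never a negative fundamental discriminant.

Mathematics. `¬ Squarefree N` gives a prime `p` with `p² ∣ N` (`Nat.squarefree_iff_prime_squarefree`;
this includes `N = 0`), and `N ∣ N s ∣ d`. If `p` is odd then `p² ∣ d`, so neither `−d` nor `(−d)/4`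
is squarefree. If `p = 2` then `4 ∣ N s` and `4 ∣ 4 c³ ∸ N s`, hence `16 ∣ d`, so `−d ≡ 0 (mod 4)`
and `(−d)/4 ≡ 0 (mod 4)`, excluding both branches of `IsNegFundamentalDiscr`. A truncating
subtraction gives `d = 0`, which both divisibility arguments cover as well.

The two divisibility exclusions are the same arguments as the helper theorems
`not_isNegFundamentalDiscr_of_sixteen_dvd` / `not_isNegFundamentalDiscr_of_odd_prime_sq_dvd` of the
sibling stub file `ArithStatLadderIqThreeNotPPolyStubOneSided` (stub `stub_oneSided`) and of
`ArithStatLadderIqThreeNotPPolyStubOneSidedAP` (stub `stub_oneSidedAP`); they are inlined here so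
that this file builds from `HallgrenClassGroup` alone.
-/

set_option linter.dupNamespace false -- D-0017: single-problem summit ⇒ `QuantumAdvantage.QuantumAdvantage` by design

namespace Summit.QuantumAdvantage.QuantumAdvantage.Theorems.IqThreeNotPPoly

open scoped Classical
open Literature.Computability.Cryptography (IsNegFundamentalDiscr)
open Literature.NumberTheory.QuadraticFields

/-- **Stub F · `stub_oneSidedNG`** (ONE-SIDEDNESS, exact). For a non-squarefree modulus `N`, the
number `d = N s · (4 c³ ∸ N s)` (`c = 1 + 2³⁰ N⁵`, `s = 1 + 6 c N k`) is never such that `−d` is a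
negative fundamental discriminant: `d` inherits the square factor of `N` (`p` odd: `p² ∣ N ∣ d`, so
neither `−d` nor `(−d)/4` is squarefree; `p = 2`: `4 ∣ N s` and `4 ∣ 4 c³ ∸ N s`, so `16 ∣ d` and
both residue conditions `−d ≡ 1 (mod 4)` / `(−d)/4 ≡ 2, 3 (mod 4)` fail). -/
theorem stub_oneSidedNG :
    ∀ (N k : ℕ), ¬ Squarefree N →
      ¬ IsNegFundamentalDiscr (N * (1 + 6 * (1 + 2 ^ 30 * N ^ 5) * N * k) *
        (4 * (1 + 2 ^ 30 * N ^ 5) ^ 3 - N * (1 + 6 * (1 + 2 ^ 30 * N ^ 5) * N * k))) := by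
  intro N k hN
  rw [Nat.squarefree_iff_prime_squarefree] at hN
  push Not at hN
  obtain ⟨p, hp, hpN⟩ := hN
  -- `N ∣ N s`
  have hNA : N ∣ N * (1 + 6 * (1 + 2 ^ 30 * N ^ 5) * N * k) := dvd_mul_right N _
  generalize hd : N * (1 + 6 * (1 + 2 ^ 30 * N ^ 5) * N * k) *
    (4 * (1 + 2 ^ 30 * N ^ 5) ^ 3 - N * (1 + 6 * (1 + 2 ^ 30 * N ^ 5) * N * k)) = d
  rcases eq_or_ne p 2 with rfl | hp2
  · -- `4 ∣ N`, hence `4 ∣ N s` and `4 ∣ 4 c³ ∸ N s`, so `16 ∣ d`: both residue conditions fail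
    have h4 : 4 ∣ N := hpN
    have h4A : 4 ∣ N * (1 + 6 * (1 + 2 ^ 30 * N ^ 5) * N * k) := h4.trans hNA
    have hu : 4 ∣ 4 * (1 + 2 ^ 30 * N ^ 5) ^ 3 - N * (1 + 6 * (1 + 2 ^ 30 * N ^ 5) * N * k) :=
      Nat.dvd_sub (dvd_mul_right 4 _) h4A
    have h16 : 16 ∣ d := by
      rw [← hd]
      exact dvd_trans (by decide : (16 : ℕ) ∣ 4 * 4) (Nat.mul_dvd_mul h4A hu)
    clear hd hNA h4A hu
    rintro (⟨h1, -, -⟩ | ⟨-, h2, -⟩) <;> omega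
  · -- `p` odd, `p² ∣ N ∣ N s ∣ d`: neither `−d` nor `(−d)/4` is squarefree
    have hpd : p * p ∣ d := hd ▸ ((hpN.trans hNA).mul_right _)
    have hpu : ¬ IsUnit p := hp.not_isUnit
    clear hd hNA
    rintro (⟨-, hsq, -⟩ | ⟨h4, -, hsq⟩)
    · rw [← Int.squarefree_natAbs, Int.natAbs_neg, Int.natAbs_natCast] at hsq
      exact hpu (hsq p hpd)
    · have h4' : 4 ∣ d := Int.natCast_dvd_natCast.1 (dvd_neg.1 h4)
      obtain ⟨q, rfl⟩ := h4'
      have he : (-((4 * q : ℕ) : ℤ)) / 4 = -(q : ℤ) := by push_cast; omega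
      rw [he, ← Int.squarefree_natAbs, Int.natAbs_neg, Int.natAbs_natCast] at hsq
      have hcop : Nat.Coprime (p * p) 4 := by
        simpa [pow_two] using Nat.coprime_pow_primes 2 2 hp Nat.prime_two hp2
      exact hpu (hsq p (hcop.dvd_of_dvd_mul_left hpd))

end Summit.QuantumAdvantage.QuantumAdvantage.Theorems.IqThreeNotPPoly
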